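import Literature.MathematicalPhysics.QuantumFieldTheory.Balaban1983to89.B9Eq342CoshWeightSite

/-!
# `Balaban1983to89.B9Eq342GradientRowBlockCurrency` — T. Bałaban, *Propagators for lattice gauge theories in a background field*, Commun. Math. Phys. **99**
# (1985) 389–434 [Balaban1985BackgroundPropagators] Thm 3.1 (3.42) p. 397 (the decay factor `e^{−δ₀d(y,y′)}` «for x ∈ Δ(y), y′ ∈ Λ_j, supp λ ⊂ Δ(y′)»),
# (3.49) p. 399, with [Balaban1984PropagatorsI] p. 36 (the `cosh` weight): **THE CURRENCY JUNCTION OF STOREY J — from the WEIGHTED rows (product-`cosh` weight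
# `W_{x₀}` CENTRED AT THE OUTPUT site, `B9Eq342GradientRowAssembly` ∕ `B9Eq326LocalPartDivergenceRow`) to the BLOCK-DECAY letter (L) of the cell
# (`‖(Tf)(y)‖ ≤ B·e^{−κ·d_m(πy, v)}·sup|f|` for `f` supported in the block `Δ(v)`, ne9-leaf-03's `B9Eq347*`): (A) a block-decay bound from the source block
# `‖g(x)‖ ≤ G·e^{−κ·d_m(πx, v)}` IS a weighted row relative to EVERY centre `y`, `‖g(x)‖ ≤ (2e^{a(L−1)}·G·e^{−κ·d_m(πy, v)})·W_y(x)`, as soon as `κ ≤ aL`;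
# (B) a field supported in `Δ(v)` with `sup ≤ F` has the row `(2e^{a(L−1)}·F·e^{−aL·d_m(πy, v)})·W_y`; (C) a row functional `‖g(y)‖ ≤ (A·Γ + B·N_u)·W_y(y)`
# valid for every centre (storey J's conclusion shape, `W_y(y) = 1`) then gives `‖g(y)‖ ≤ 2e^{a(L−1)}·(A + B·C_u)·F·e^{−κ·d_m(πy, v)}` — the letter (L)**
# (the OWNER's plan v11 §2 (ii) ∕ §3 «with storey J's gradient rows … the G₁ sup row by … leaf-03's letter algebra (H)∕(K)∕(G)»)

statement-level skeleton of published theorems with citation tags; proofs where landed; nothing here is a claim about the Yang–Mills mass gap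

CITATION HEADER (lean-in-tree rule).  Audit cell `pub-balaban`, sub-cell `t4`, BINDER row NE9; filed by NE9 crux-team LEAF PROVER 05
(`b2b-balaban-t4-ne9-formalise-leaf-05`, gen 85).  Imports the OWNER's `B9Eq342CoshWeightSite` ONLY (g90: `weight_site_pos`, `weight_site_centre`,
`exp_blockDist_le_weight_site` — the block-distance domination `e^{aL·d_m(πx₀,πx)} ≤ 2e^{a(L−1)}·W_{x₀}(x)`; through it `B4Sect5Torus.tdist_triangle` ∕ `tdist_symm`).
SOURCE READ first-hand in the held text layer [Balaban1985BackgroundPropagators] (`paper:balaban1985-cmp99-background-propagators`): p. 397 Thm 3.1 (3.42) and the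
sentence on `x ∈ Δ(y)`, `supp λ ⊂ Δ(y′)`; p. 399 (3.49).  [folklore] triangle inequality for the coarse sup-distance `d_m` + the tree's domination letter; nothing
printed is a hypothesis; the `[cite: …]` tags are TEXT LOCATIONS.  The junction was named by t4-ne9-idea-1 (L-g150-2) as the step between the cell's two currencies.

WHAT IS PROVED (sorry-free; 0 `def`; [folklore]).  Fine torus `TSite d (fineP L m)` (`1 ≤ m_i`), `π = blockCoord L m`, `d_m = tdist m`, a rate `0 ≤ a`, the weight
`W_y(x) = Π_μ cosh(a·circAbs(x_μ − y_μ))` of `B9Eq342CoshWeightSite` (= `B9Eq342GradientRowAssembly`'s `WT` at `x₀ := y`), fields indexed by any type `ι` read at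
sites through `s : ι → TSite` (`s = id` for site fields, `s = Prod.fst` for bond fields).
* §1 **`exp_neg_blockDist_le_weight`** — `κ ≤ aL` ⟹ `e^{−κ·d_m(πx, v)} ≤ 2e^{a(L−1)}·e^{−κ·d_m(πy, v)}·W_y(x)` for all `x, y, v`;
  **`weighted_row_of_block_decay`** — (A) above; **`weighted_row_of_block_support`** — (B) above (any `κ ≤ aL` as the displayed rate).
* §2 **`block_letter_of_centre_rows`** — (C) above: the data `f` supported over `Δ(v)` with `sup ≤ F`, the value field `u` with block decay `C_u·F·e^{−κ d_m(π·, v)}`,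
  `κ ≤ aL`, and a row functional `hrow` (for every centre `y` and all `Γ, N_u ≥ 0`: rows of `f`, `u` relative to `W_y` ⟹ `‖g(y)‖ ≤ (A·Γ + B·N_u)·W_y(y)`) ⟹
  `‖g(y)‖ ≤ 2e^{a(L−1)}·(A + B·C_u)·F·e^{−κ·d_m(πy, v)}`.
HONEST SCOPE.  Currency bookkeeping only; the row functional (storey J), the block decay of `u` (the OWNER's (D0)∕(I0) read pointwise), and the rate window
`κ ≤ aL` against storey J's `2dt²(cosh a − 1) < m` are the consumer's; nothing of [B9] Thm 3.1∕3.3∕3.11 is asserted, valued or discharged.  NOT NE9 (cell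
pub-balaban: NE9 NOT PRINTED ∕ NOT PROVED; «NE9 ⇐ the named binders»; row WALLED ON A MODEL (O-NE9-1; #5 UNRULED); spine PROVED 0∕9; rung (B)+1 on a finite T⁴ —
NOT infinite volume, NOT mass gap, NOT Clay; HONEST DEPENDENCY: continuum YM on T⁴ ⇐ BetaPertH ∧ nine spine estimates (0/9 proved); BetaPertH ⇐ (D1) ∧ (D4) ∧
CAP+tail; G-an2-4 gates asym, D1 and NE2/3/4).  NEW file; nothing modified.  Net new unproved facts: 0.
-/

noncomputable section

set_option autoImplicit false

open scoped BigOperators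

namespace Literature.MathematicalPhysics.QuantumFieldTheory.Balaban1983to89.B9Eq342GradientRowBlockCurrency

open B4Sect5Torus (TSite tdist tdist_triangle tdist_symm tdist_self)
open B4TorusKernel.MultiPeriod (circAbs)
open B9Eq319QprimeTorus (fineP blockCoord)
open B9Eq342CoshWeightSite (weight_site_pos weight_site_centre exp_blockDist_le_weight_site neZero_fineP)

variable {d : ℕ} (L : ℕ) [NeZero L] (m : Fin d → ℕ) (hm : ∀ i, 1 ≤ m i) {a : ℝ} (ha : 0 ≤ a)

/-! ## §1 A block-decay bound from the source is a weighted row relative to every centre -/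

include hm ha in
/-- **`e^{−κ·d_m(πx, v)} ≤ 2e^{a(L−1)}·e^{−κ·d_m(πy, v)}·W_y(x)` FOR `0 ≤ κ ≤ aL`**: the triangle inequality `d_m(πy, v) ≤ d_m(πy, πx) + d_m(πx, v)` and the
domination `e^{aL·d_m(πy,πx)} ≤ 2e^{a(L−1)}·W_y(x)` (`B9Eq342CoshWeightSite.exp_blockDist_le_weight_site`). [folklore]
[cite: Balaban1985BackgroundPropagators, Thm 3.1 (3.42) p.397, (3.49) p.399; Balaban1984PropagatorsI, p.36] -/
theorem exp_neg_blockDist_le_weight {κ : ℝ} (hκ : 0 ≤ κ) (hκa : κ ≤ a * (L : ℝ)) (v : TSite d m) (y x : TSite d (fineP L m)) :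
    Real.exp (-(κ * tdist m (blockCoord L m x) v)) ≤
      2 * Real.exp (a * ((L : ℝ) - 1)) * Real.exp (-(κ * tdist m (blockCoord L m y) v)) * (fun x : TSite d (fineP L m) =>
        ∏ μ, Real.cosh (a * (circAbs (fineP L m μ) (ZMod.val (((y μ : ℕ) : ZMod (fineP L m μ)) - ((x μ : ℕ) : ZMod (fineP L m μ)))) : ℝ))) x := by
  haveI := neZero_fineP L m hm
  have htri : tdist m (blockCoord L m y) v ≤ tdist m (blockCoord L m y) (blockCoord L m x) + tdist m (blockCoord L m x) v :=
    tdist_triangle hm _ _ _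
  have hD : 0 ≤ tdist m (blockCoord L m y) (blockCoord L m x) := by
    unfold tdist; positivity
  -- `e^{−κ d(πx,v)} ≤ e^{−κ d(πy,v)}·e^{κ d(πy,πx)} ≤ e^{−κ d(πy,v)}·e^{aL d(πy,πx)}`
  have h1 : Real.exp (-(κ * tdist m (blockCoord L m x) v)) ≤
      Real.exp (-(κ * tdist m (blockCoord L m y) v)) * Real.exp (a * (L : ℝ) * tdist m (blockCoord L m y) (blockCoord L m x)) := by
    rw [← Real.exp_add]
    refine Real.exp_le_exp.mpr ?_
    nlinarith [mul_le_mul_of_nonneg_right hκa hD, mul_le_mul_of_nonneg_left htri hκ]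
  have h2 := exp_blockDist_le_weight_site L m hm ha y x
  have hpos : 0 ≤ Real.exp (-(κ * tdist m (blockCoord L m y) v)) := (Real.exp_pos _).le
  calc Real.exp (-(κ * tdist m (blockCoord L m x) v))
      ≤ Real.exp (-(κ * tdist m (blockCoord L m y) v)) * Real.exp (a * (L : ℝ) * tdist m (blockCoord L m y) (blockCoord L m x)) := h1
    _ ≤ Real.exp (-(κ * tdist m (blockCoord L m y) v)) * (Real.exp (a * ((L : ℝ) - 1)) * 2 * (fun x : TSite d (fineP L m) =>
        ∏ μ, Real.cosh (a * (circAbs (fineP L m μ) (ZMod.val (((y μ : ℕ) : ZMod (fineP L m μ)) - ((x μ : ℕ) : ZMod (fineP L m μ)))) : ℝ))) x) := mul_le_mul_of_nonneg_left h2 hpos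
    _ = 2 * Real.exp (a * ((L : ℝ) - 1)) * Real.exp (-(κ * tdist m (blockCoord L m y) v)) * (fun x : TSite d (fineP L m) =>
        ∏ μ, Real.cosh (a * (circAbs (fineP L m μ) (ZMod.val (((y μ : ℕ) : ZMod (fineP L m μ)) - ((x μ : ℕ) : ZMod (fineP L m μ)))) : ℝ))) x := by ring

include hm ha in
/-- **(A) A BLOCK-DECAY BOUND IS A WEIGHTED ROW RELATIVE TO EVERY CENTRE**: `‖g(i)‖ ≤ G·e^{−κ·d_m(π(s i), v)}` for all `i` (`0 ≤ G`, `0 ≤ κ ≤ aL`) ⟹ for every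
centre `y`: `‖g(i)‖ ≤ (2e^{a(L−1)}·G·e^{−κ·d_m(πy, v)})·W_y(s i)` — the value row `N_u` of storey J with the decay in its constant. [folklore]
[cite: Balaban1985BackgroundPropagators, Thm 3.1 (3.42) p.397, (3.49) p.399] -/
theorem weighted_row_of_block_decay {ι E : Type*} [SeminormedAddCommGroup E] (s : ι → TSite d (fineP L m)) (g : ι → E) (v : TSite d m) {G κ : ℝ}
    (hG : 0 ≤ G) (hκ : 0 ≤ κ) (hκa : κ ≤ a * (L : ℝ)) (hg : ∀ i, ‖g i‖ ≤ G * Real.exp (-(κ * tdist m (blockCoord L m (s i)) v)))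
    (y : TSite d (fineP L m)) (i : ι) :
    ‖g i‖ ≤ (2 * Real.exp (a * ((L : ℝ) - 1)) * G * Real.exp (-(κ * tdist m (blockCoord L m y) v))) * (fun x : TSite d (fineP L m) =>
        ∏ μ, Real.cosh (a * (circAbs (fineP L m μ) (ZMod.val (((y μ : ℕ) : ZMod (fineP L m μ)) - ((x μ : ℕ) : ZMod (fineP L m μ)))) : ℝ))) (s i) := by
  have h := exp_neg_blockDist_le_weight L m hm ha hκ hκa v y (s i)
  calc ‖g i‖ ≤ G * Real.exp (-(κ * tdist m (blockCoord L m (s i)) v)) := hg i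
    _ ≤ G * (2 * Real.exp (a * ((L : ℝ) - 1)) * Real.exp (-(κ * tdist m (blockCoord L m y) v)) * (fun x : TSite d (fineP L m) =>
        ∏ μ, Real.cosh (a * (circAbs (fineP L m μ) (ZMod.val (((y μ : ℕ) : ZMod (fineP L m μ)) - ((x μ : ℕ) : ZMod (fineP L m μ)))) : ℝ))) (s i)) := mul_le_mul_of_nonneg_left h hG
    _ = _ := by ring

include hm ha in
/-- **(B) A FIELD SUPPORTED OVER ONE BLOCK IS A WEIGHTED ROW RELATIVE TO EVERY CENTRE**: `f` vanishing at the `i` with `π(s i) ≠ v`, `‖f(i)‖ ≤ F` (`0 ≤ F`), any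
displayed rate `0 ≤ κ ≤ aL` ⟹ `‖f(i)‖ ≤ (2e^{a(L−1)}·F·e^{−κ·d_m(πy, v)})·W_y(s i)` — the data row `Γ` of storey J. [folklore]
[cite: Balaban1985BackgroundPropagators, Thm 3.1 (3.42) p.397 («supp λ ⊂ Δ(y′)»), (3.49) p.399] -/
theorem weighted_row_of_block_support {ι E : Type*} [SeminormedAddCommGroup E] (s : ι → TSite d (fineP L m)) (f : ι → E) (v : TSite d m) {F κ : ℝ}
    (hF : 0 ≤ F) (hκ : 0 ≤ κ) (hκa : κ ≤ a * (L : ℝ)) (hfv : ∀ i, blockCoord L m (s i) ≠ v → f i = 0) (hf : ∀ i, ‖f i‖ ≤ F)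
    (y : TSite d (fineP L m)) (i : ι) :
    ‖f i‖ ≤ (2 * Real.exp (a * ((L : ℝ) - 1)) * F * Real.exp (-(κ * tdist m (blockCoord L m y) v))) * (fun x : TSite d (fineP L m) =>
        ∏ μ, Real.cosh (a * (circAbs (fineP L m μ) (ZMod.val (((y μ : ℕ) : ZMod (fineP L m μ)) - ((x μ : ℕ) : ZMod (fineP L m μ)))) : ℝ))) (s i) := by
  refine weighted_row_of_block_decay L m hm ha s f v hF hκ hκa (fun j => ?_) y i
  by_cases hj : blockCoord L m (s j) = v
  · rw [hj, tdist_self, mul_zero, neg_zero, Real.exp_zero, mul_one]; exact hf j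
  · rw [hfv j hj, norm_zero]; positivity

/-! ## §2 From storey J's centred row functional to the block letter (L) -/

include hm ha in
/-- **(C) THE BLOCK LETTER FROM THE CENTRED ROWS.**  Data `f` supported over `Δ(v)` with `sup ≤ F`; a value field `u` with the block decay
`‖u(j)‖ ≤ C_u·F·e^{−κ·d_m(π(s_u j), v)}` (`0 ≤ C_u`, `0 ≤ κ ≤ aL`); an output `g` on sites obeying, FOR EVERY CENTRE `y` and all `Γ, N_u ≥ 0`, the row functional
`(∀ i, ‖f i‖ ≤ Γ·W_y(s_f i)) → (∀ j, ‖u j‖ ≤ N_u·W_y(s_u j)) → ‖g(y)‖ ≤ (A·Γ + B·N_u)·W_y(y)` (any `A, B`; storey J's conclusion with `N_P` folded into `B`)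
⟹ **`‖g(y)‖ ≤ 2e^{a(L−1)}·(A + B·C_u)·F·e^{−κ·d_m(πy, v)}`** — the letter (L) of the map `f ↦ g` at rate `κ`, since `W_y(y) = 1`. [folklore]
[cite: Balaban1985BackgroundPropagators, Thm 3.1 (3.42) p.397, (3.49) p.399] -/
theorem block_letter_of_centre_rows {ι ι' E E' E'' : Type*} [SeminormedAddCommGroup E] [SeminormedAddCommGroup E'] [SeminormedAddCommGroup E'']
    (sf : ι → TSite d (fineP L m)) (su : ι' → TSite d (fineP L m)) (f : ι → E) (u : ι' → E') (g : TSite d (fineP L m) → E'') (v : TSite d m)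
    {F Cu κ A B : ℝ} (hF : 0 ≤ F) (hCu : 0 ≤ Cu) (hκ : 0 ≤ κ) (hκa : κ ≤ a * (L : ℝ))
    (hfv : ∀ i, blockCoord L m (sf i) ≠ v → f i = 0) (hf : ∀ i, ‖f i‖ ≤ F)
    (hu : ∀ j, ‖u j‖ ≤ Cu * F * Real.exp (-(κ * tdist m (blockCoord L m (su j)) v)))
    (hrow : ∀ (y : TSite d (fineP L m)) (Γ Nu : ℝ), 0 ≤ Γ → 0 ≤ Nu →
      (∀ i, ‖f i‖ ≤ Γ * (fun x : TSite d (fineP L m) =>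
        ∏ μ, Real.cosh (a * (circAbs (fineP L m μ) (ZMod.val (((y μ : ℕ) : ZMod (fineP L m μ)) - ((x μ : ℕ) : ZMod (fineP L m μ)))) : ℝ))) (sf i)) → (∀ j, ‖u j‖ ≤ Nu * (fun x : TSite d (fineP L m) =>
        ∏ μ, Real.cosh (a * (circAbs (fineP L m μ) (ZMod.val (((y μ : ℕ) : ZMod (fineP L m μ)) - ((x μ : ℕ) : ZMod (fineP L m μ)))) : ℝ))) (su j)) → ‖g y‖ ≤ (A * Γ + B * Nu) * (fun x : TSite d (fineP L m) =>
        ∏ μ, Real.cosh (a * (circAbs (fineP L m μ) (ZMod.val (((y μ : ℕ) : ZMod (fineP L m μ)) - ((x μ : ℕ) : ZMod (fineP L m μ)))) : ℝ))) y)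
    (y : TSite d (fineP L m)) :
    ‖g y‖ ≤ 2 * Real.exp (a * ((L : ℝ) - 1)) * (A + B * Cu) * F * Real.exp (-(κ * tdist m (blockCoord L m y) v)) := by
  haveI := neZero_fineP L m hm
  have hΓ := weighted_row_of_block_support L m hm ha sf f v hF hκ hκa hfv hf y
  have hNu := weighted_row_of_block_decay L m hm ha su u v (mul_nonneg hCu hF) hκ hκa hu y
  have h := hrow y _ _ (by positivity) (by positivity) hΓ hNu
  beta_reduce at h
  rw [weight_site_centre (fineP L m) a y, mul_one] at h
  exact h.trans (le_of_eq (by ring))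

end Literature.MathematicalPhysics.QuantumFieldTheory.Balaban1983to89.B9Eq342GradientRowBlockCurrency

end
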